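import Mathlib
import Summits.NavierStokesRegularity.FluidComputer.TransportGalerkinEmergenceH2
import HarnessLib

/-!
# Galerkin limit of the transport model, XVII: the TRUE SOLUTION EXISTS on the window and is UNIQUE in the class (instab g20, cell `ns-blowup`, 2026-08-27)

HONEST FRAMING (human ruling D-0035): nothing here is a claim about Navier–Stokes blow-up.
WHAT THIS IS NOT: not NS — a MODEL theorem schema (perturbation equation about a smooth host on
`𝕋^d` in the scaled phase space `E = lp (ℤ^d → V) 2`). No number or census word moves.

PURPOSE. The KEEP/KILL entry points of g19 (`TransportGalerkinEmergenceLevels.half_prediction_nsField_of_levels`,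
`TransportGalerkinKillLevels.decay_two_nsField_of_levels`; forced-ABC instances
`TransportGalerkinAbcFinal.exists_keep_eigenvector_abc_final` / `TransportGalerkinAbcKillFinal.decay_two_abc_final`)
conclude «for EVERY classical solution `w` of the model on `[0, T]` from the seed, read in the class
with a uniform polynomial tail of scaled order `d + 3` and the three linear clauses». This file makes
that sentence a statement about THE solution. NON-VACUITY (`exists_solution_of_levelBound`): from the
inputs the chain already uses (host with `ν > 0`; a rapidly decreasing constrained seed `z`; its
Galerkin levels at `cubeProj (n + K)` on `[0, T]` as `C¹` solutions of the finite-dimensional ODE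
keeping the clauses; ONE `E`-bound `‖u n t‖ ≤ r` — the bound the KEEP / KILL bootstraps propagate)
there EXISTS a classical solution `w` on `[0, T]` from `z` in that class, the UNIFORM LIMIT of the
levels (g19's residence box with the radius made explicit, `exists_residence_radius`; the tree's
`TransportGalerkinShift.galerkinSetting_nsField_shift`; the Wilczak–Zgliczyński `C⁰`-limit
`Literature.Analysis.ODE.GalerkinConvergenceSetting.exists_limit`). UNIQUENESS IN THE CLASS
(`tendstoUniformlyOn_of_solution`, `eqOn_of_solutions`): every class solution from `z` (any tail
constant) is that limit; two such solutions agree on `[0, T]` (`limit_unique` in a box whose floor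
covers both tails). General finite `d`, Hilbert proper `V`; Mathlib + the tree files cited; no new
definitions. Uniqueness beyond the class (every `E`-continuous solution) is NOT claimed here.
-/

noncomputable section

open scoped ENNReal NNReal ComplexConjugate InnerProductSpace
open Set Filter Topology

namespace Summit.NavierStokesRegularity.FluidComputer.TransportGalerkinExistence

open RCLike
open Literature.Analysis.FunctionSpaces Literature.Analysis.FunctionSpaces.Lattice
open Literature.Analysis.FunctionSpaces.Torus
open Literature.Analysis.ODE
open Summit.NavierStokesRegularity.FluidComputer.GalerkinLatticePhaseSpace
open Summit.NavierStokesRegularity.FluidComputer.TransportGalerkin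
open Summit.NavierStokesRegularity.FluidComputer.TransportGalerkinRapid
open Summit.NavierStokesRegularity.FluidComputer.TransportGalerkinBox
open Summit.NavierStokesRegularity.FluidComputer.TransportGalerkinResidencePrep
open Summit.NavierStokesRegularity.FluidComputer.TransportGalerkinResidence
open Summit.NavierStokesRegularity.FluidComputer.TransportGalerkinResidenceBox
open Summit.NavierStokesRegularity.FluidComputer.TransportGalerkinShift
open Summit.NavierStokesRegularity.FluidComputer.TransportGalerkinEmergenceH2

variable {d : Type*} [Fintype d] [DecidableEq d]
variable {V : Type*} [NormedAddCommGroup V] [InnerProductSpace ℂ V] [CompleteSpace V] [ProperSpace V]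
variable {ν : ℝ} {Uv : (d → ℤ) → V} {π : d → (V →L[ℂ] ℂ)} {P : (d → ℤ) → (V →L[ℂ] V)}

/-! ## §1 The residence box with its radius made explicit -/

section Radius

omit [ProperSpace V] in
/-- **ONE polynomial radius for a bounded family of Galerkin levels** (`exists_residence_radius`):
the content of `TransportGalerkinResidenceBox.exists_residence_box` with the radii exhibited in the
closed form `ρ k = C_ρ ⟨k⟩^{−(d+3)}`, `C_ρ ≥ C₀` (any prescribed `C₀ ≥ 0`). Host with `ν > 0`;
a family `y i` of trajectories on `[0, T]`, right-differentiable on `[0, T)` with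
`(y i)' = P_{N i} F(y i)`, `P_{N i}`-fixed, in `box ρ₀ π P` (linear clauses), with common bounds
`‖y i t‖ ≤ r` and `E₃`, `E_σ` on the initial energies of orders `3` and `σ = card d + 5`.
Conclusion: `‖(y i t) k‖ ≤ C_ρ ⟨k⟩^{−(d+3)}` for every `i`, `t ∈ [0, T]`, `k` (orders three and `σ` on
the window by `energy_three_le` / `energy_le_of_energy_three_le`, then coordinates). -/
theorem exists_residence_radius (hν : 0 < ν) (hUv : RapidDecay Uv) (hπ : ∀ j, ‖π j‖ ≤ 1)
    (hUreal : ∀ j p, π j (Uv (-p)) = conj (π j (Uv p)))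
    (hUdiv : ∑ j, freqDeriv j (fun p => π j (Uv p)) = 0)
    (hPsa : ∀ k, IsSelfAdjoint (P k)) (hP : ∀ k, ‖P k‖ ≤ 1)
    (hσ₂ : ∑' l : d → ℤ, ENNReal.ofReal (sobolevWeight (-2) l ^ 2) < ∞)
    {ρ₀ : (d → ℤ) → ℝ}
    {ι : Type*} {N : ι → ℕ} {y : ι → ℝ → lp (fun _ : (d → ℤ) => V) 2} {T r E₃ Eσ C₀ : ℝ}
    (hr : 0 < r) (hE₃ : 0 ≤ E₃) (hEσ : 0 ≤ Eσ) (hC₀ : 0 ≤ C₀)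
    (hcont : ∀ i, ContinuousOn (y i) (Icc 0 T))
    (hderiv : ∀ i, ∀ t ∈ Ico 0 T,
      HasDerivWithinAt (y i) (cubeProj (N i) (nsField ν Uv π P (y i t))) (Ici t) t)
    (hproj : ∀ i, ∀ t ∈ Icc 0 T, cubeProj (N i) (y i t) = y i t)
    (hW : ∀ i, ∀ t ∈ Icc 0 T, y i t ∈ box ρ₀ π P)
    (hbd : ∀ i, ∀ t ∈ Icc 0 T, ‖y i t‖ ≤ r)
    (h3 : ∀ i, (eNormSq 3 (wmul (-2) ⇑(y i 0))).toReal ≤ E₃)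
    (hσ0 : ∀ i, (eNormSq ((Fintype.card d + 5 : ℕ) : ℝ) (wmul (-2) ⇑(y i 0))).toReal ≤ Eσ) :
    ∃ Cρ : ℝ, C₀ ≤ Cρ ∧ ∀ i, ∀ t ∈ Icc 0 T, ∀ k,
      ‖(y i t : (d → ℤ) → V) k‖ ≤ Cρ * sobolevWeight (-((Fintype.card d : ℝ) + 3)) k := by
  set σ : ℕ := Fintype.card d + 5 with hσdef
  have hσ1 : 1 ≤ σ := by omega
  -- the order-three constants (as in `energy_three_le`)
  set α₃ : ℝ := 2 * ν * (2 * Real.pi) ^ 2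
      + 2 * ((3 * (2 : ℝ) ^ 3) * (2 * Real.pi) *
          (∑ j, (symbNorm (3 : ℝ) (scal (fun p => π j (Uv p)) : (d → ℤ) → (V →L[ℂ] V))).toReal)
        + (2 : ℝ) ^ ((3 : ℝ) / 2) * ((Fintype.card d : ℝ) * (2 * Real.pi)) *
          (∑' l, ENNReal.ofReal (sobolevWeight 4 l) * ‖Uv l‖ₑ).toReal) with hα₃
  set β₃ : ℝ := 27 * (2 * ((Fintype.card d : ℝ) * (3 * (2 : ℝ) ^ 3) * (2 * Real.pi)) *
          Real.sqrt (∑' l : d → ℤ, ENNReal.ofReal (sobolevWeight (-2) l ^ 2)).toReal) ^ 4 /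
      (256 * (2 * ν * (2 * Real.pi) ^ 2 / r ^ 2) ^ 3) with hβ₃
  have hα₃0 : 0 ≤ α₃ := by positivity
  have hβ₃0 : 0 ≤ β₃ := by positivity
  set R₃ : ℝ := (E₃ + β₃ * |T|) * Real.exp (α₃ * |T|) with hR₃
  have hR₃0 : 0 ≤ R₃ := by positivity
  -- order three on the window
  have hS3 : ∀ i, ∀ t ∈ Icc 0 T, (eNormSq 3 (wmul (-2) ⇑(y i t))).toReal ≤ R₃ := by
    intro i t ht
    have hT : T = |T| := (abs_of_nonneg (ht.1.trans ht.2)).symm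
    have h := energy_three_le hν hUv hπ hUreal hUdiv hPsa hP hσ₂ hr (hcont i) (hderiv i) (hproj i)
      (hW i) (hbd i) t ht
    refine h.trans ((gronwallBound_le_window ENNReal.toReal_nonneg hα₃0 hβ₃0 ht.1
      (ht.2.trans_eq hT)).trans ?_)
    rw [hR₃]
    exact mul_le_mul_of_nonneg_right (add_le_add_left (h3 i) _) (Real.exp_pos _).le
  -- order σ on the window
  set ασ : ℝ := 2 * ν * (2 * Real.pi) ^ 2
      + 2 * ((σ * (2 : ℝ) ^ σ) * (2 * Real.pi) *
          (∑ j, (symbNorm (σ : ℝ) (scal (fun p => π j (Uv p)) : (d → ℤ) → (V →L[ℂ] V))).toReal)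
        + (2 : ℝ) ^ ((σ : ℝ) / 2) * ((Fintype.card d : ℝ) * (2 * Real.pi)) *
          (∑' l, ENNReal.ofReal (sobolevWeight ((σ : ℝ) + 1) l) * ‖Uv l‖ₑ).toReal)
      + 2 * ((Fintype.card d : ℝ) * (σ * (2 : ℝ) ^ σ) * (2 * Real.pi)) *
          Real.sqrt (∑' l : d → ℤ, ENNReal.ofReal (sobolevWeight (-2) l ^ 2)).toReal *
          Real.sqrt R₃ with hασ
  have hασ0 : 0 ≤ ασ := by positivity
  set R : ℝ := Eσ * Real.exp (ασ * |T|) with hR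
  have hR0 : 0 ≤ R := by positivity
  have hSσ : ∀ i, ∀ t ∈ Icc 0 T, (eNormSq (σ : ℝ) (wmul (-2) ⇑(y i t))).toReal ≤ R := by
    intro i t ht
    have hT : t ≤ |T| := ht.2.trans (le_abs_self T)
    have h := energy_le_of_energy_three_le hν.le hUv hπ hUreal hUdiv hPsa hP hσ₂ hσ1 hR₃0 (hcont i)
      (hderiv i) (hproj i) (hW i) (hS3 i) t ht
    refine h.trans ?_
    rw [hR]
    exact mul_le_mul (hσ0 i) (Real.exp_le_exp.2 (mul_le_mul_of_nonneg_left hT hασ0))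
      (Real.exp_pos _).le hEσ
  -- the radius
  refine ⟨Real.sqrt R + C₀, le_add_of_nonneg_left (Real.sqrt_nonneg _), fun i t ht k => ?_⟩
  have hxr : RapidDecay (⇑(y i t)) := by rw [← hproj i t ht]; exact rapidDecay_coe_cubeProj (N i) (y i t)
  have hs : ((σ : ℝ) - 2) = (Fintype.card d : ℝ) + 3 := by rw [hσdef]; push_cast; ring
  have hfin : eNormSq ((σ : ℝ) - 2) (⇑(y i t)) < ∞ := eNormSq_lt_top_of_rapidDecay hxr _
  have hle : (eNormSq ((σ : ℝ) - 2) (⇑(y i t))).toReal ≤ R := by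
    rw [← eNormSq_unscale]; exact hSσ i t ht
  calc ‖(y i t : (d → ℤ) → V) k‖ ≤ Real.sqrt R * sobolevWeight (-((σ : ℝ) - 2)) k :=
        norm_apply_le_of_eNormSq_le hfin hle k
    _ ≤ (Real.sqrt R + C₀) * sobolevWeight (-((Fintype.card d : ℝ) + 3)) k := by
        rw [hs]
        exact mul_le_mul_of_nonneg_right (le_add_of_nonneg_right hC₀) (sobolevWeight_pos _ _).le

end Radius

/-! ## §2 The Wilczak–Zgliczyński setting of the levels of ONE seed, from the `E`-bound -/

section Setting

/-- **The convergence setting of the Galerkin levels of one seed, from the level bound alone**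
(`exists_setting_of_levelBound`). Host with `ν > 0`; a constrained seed `z` under a polynomial floor
`‖z k‖ ≤ C₀ ⟨k⟩^{−(d+3)}`; its levels `u n` at `cubeProj (n + K)` on `[0, T]` (`T ≥ 0`) as `C¹`
solutions of the Galerkin ODE keeping the clauses, with `‖u n t‖ ≤ r`. Then for some `C_ρ ≥ C₀` and
some one-sided constant `l`, the tree's `GalerkinConvergenceSetting` holds for the levels
`cubeProj (n + K)`, the field `nsField`, the box `W = box (C_ρ ⟨·⟩^{−(d+3)}) π P`, `Z = {z}`. -/
theorem exists_setting_of_levelBound (K : ℕ) (hν : 0 < ν) (hUv : RapidDecay Uv)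
    (hUreal : ∀ j p, π j (Uv (-p)) = conj (π j (Uv p)))
    (hUdiv : ∑ j, freqDeriv j (fun p => π j (Uv p)) = 0) (hπ : ∀ j, ‖π j‖ ≤ 1)
    (hPsa : ∀ k, IsSelfAdjoint (P k)) (hPn : ∀ k, ‖P k‖ ≤ 1)
    (hσ : ∑' l : d → ℤ, ENNReal.ofReal (sobolevWeight (-2) l ^ 2) < ∞)
    {T : ℝ} (hT : 0 ≤ T)
    {z : lp (fun _ : (d → ℤ) => V) 2} (hzr : RapidDecay (⇑z)) {C₀ : ℝ} (hC₀ : 0 ≤ C₀)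
    (hzdec : ∀ k, ‖(z : (d → ℤ) → V) k‖ ≤ C₀ * sobolevWeight (-((Fintype.card d : ℝ) + 3)) k)
    (hzfix : ∀ k, P k (z k) = z k) (hzreal : ∀ j k, π j (z (-k)) = conj (π j (z k)))
    (hzdiv : ∀ k, ∑ j, ((k j : ℤ) : ℂ) * π j (z k) = 0)
    {u : ℕ → ℝ → lp (fun _ : (d → ℤ) => V) 2} {r : ℝ} (hr : 0 < r)
    (sol_continuousOn : ∀ n, ContinuousOn (u n) (Icc 0 T))
    (sol_init : ∀ n, u n 0 = cubeProj (n + K) z)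
    (sol_hasDerivWithinAt : ∀ n, ∀ t ∈ Icc 0 T,
      HasDerivWithinAt (u n) (cubeProj (n + K) (nsField ν Uv π P (u n t))) (Icc 0 T) t)
    (sol_proj : ∀ n, ∀ t ∈ Icc 0 T, cubeProj (n + K) (u n t) = u n t)
    (sol_fix : ∀ n, ∀ t ∈ Icc 0 T, ∀ k, P k ((u n t : (d → ℤ) → V) k) = (u n t : (d → ℤ) → V) k)
    (sol_real : ∀ n, ∀ t ∈ Icc 0 T, ∀ j k,
      π j ((u n t : (d → ℤ) → V) (-k)) = conj (π j ((u n t : (d → ℤ) → V) k)))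
    (sol_div : ∀ n, ∀ t ∈ Icc 0 T, ∀ k, ∑ j, ((k j : ℤ) : ℂ) * π j ((u n t : (d → ℤ) → V) k) = 0)
    (sol_bound : ∀ n, ∀ t ∈ Icc 0 T, ‖u n t‖ ≤ r) :
    ∃ Cρ l : ℝ, C₀ ≤ Cρ ∧
      GalerkinConvergenceSetting (fun n => (cubeProj (n + K) :
          lp (fun _ : (d → ℤ) => V) 2 →L[ℝ] lp (fun _ : (d → ℤ) => V) 2))
        (nsField ν Uv π P) (box (fun k => Cρ * sobolevWeight (-((Fintype.card d : ℝ) + 3)) k) π P)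
        {z} T l (fun n _ => u n) := by
  -- initial energies of the levels are dominated by those of the seed
  set E₃ : ℝ := (eNormSq 3 (wmul (-2) ⇑z)).toReal with hE₃
  set Eσ : ℝ := (eNormSq ((Fintype.card d + 5 : ℕ) : ℝ) (wmul (-2) ⇑z)).toReal with hEσ
  have hzr' : RapidDecay (wmul (-2) (⇑z)) := rapidDecay_wmul hzr (-2)
  have h3 : ∀ n, (eNormSq 3 (wmul (-2) ⇑(u n 0))).toReal ≤ E₃ := fun n => by
    rw [sol_init n, hE₃]
    exact ENNReal.toReal_mono (eNormSq_lt_top_of_rapidDecay hzr' _).ne (eNormSq_unscale_cubeProj_le _ _ _)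
  have hσ0 : ∀ n, (eNormSq ((Fintype.card d + 5 : ℕ) : ℝ) (wmul (-2) ⇑(u n 0))).toReal ≤ Eσ := fun n => by
    rw [sol_init n, hEσ]
    exact ENNReal.toReal_mono (eNormSq_lt_top_of_rapidDecay hzr' _).ne (eNormSq_unscale_cubeProj_le _ _ _)
  -- the levels lie in the coarse box of radius `r` (linear clauses + the `E`-bound)
  have hWr : ∀ n, ∀ t ∈ Icc 0 T, u n t ∈ box (fun _ => r) π P := fun n t ht =>
    mem_box.2 ⟨fun k => (norm_apply_le (u n t) k).trans (sol_bound n t ht), sol_fix n t ht,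
      sol_real n t ht, sol_div n t ht⟩
  -- right derivatives on `[0, T)`
  have hderiv : ∀ n, ∀ t ∈ Ico 0 T,
      HasDerivWithinAt (u n) (cubeProj (n + K) (nsField ν Uv π P (u n t))) (Ici t) t := by
    intro n t ht
    refine (sol_hasDerivWithinAt n t (Ico_subset_Icc_self ht)).mono_of_mem_nhdsWithin ?_
    exact Set.ordConnected_Icc.mem_nhdsGE (Ico_subset_Icc_self ht) (right_mem_Icc.2 (ht.1.trans ht.2.le)) ht.2
  -- ONE explicit radius for all levels
  obtain ⟨Cρ, hC₀ρ, hrad⟩ := exists_residence_radius (ι := ℕ) (N := fun n => n + K)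
    (y := u) (C₀ := C₀) hν hUv hπ hUreal hUdiv hPsa hPn hσ hr ENNReal.toReal_nonneg
    ENNReal.toReal_nonneg hC₀ sol_continuousOn hderiv sol_proj hWr sol_bound h3 hσ0
  set ρ : (d → ℤ) → ℝ := fun k => Cρ * sobolevWeight (-((Fintype.card d : ℝ) + 3)) k with hρ
  have hCρ0 : 0 ≤ Cρ := hC₀.trans hC₀ρ
  have hρ0 : ∀ k, 0 ≤ ρ k := fun k => mul_nonneg hCρ0 (sobolevWeight_pos _ _).le
  have hρ12 := summable_radii (d := d) Cρ
  have hmem : ∀ n, ∀ t ∈ Icc 0 T, u n t ∈ box ρ π P := fun n t ht =>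
    mem_box.2 ⟨hrad n t ht, sol_fix n t ht, sol_real n t ht, sol_div n t ht⟩
  have hzW : z ∈ box ρ π P :=
    mem_box.2 ⟨fun k => (hzdec k).trans (mul_le_mul_of_nonneg_right hC₀ρ (sobolevWeight_pos _ _).le),
      hzfix, hzreal, hzdiv⟩
  exact ⟨Cρ, _, hC₀ρ, galerkinSetting_nsField_shift K hν.le hUv hUreal hUdiv hπ hPsa hPn hρ0 hρ12.1 hρ12.2
    (Z := {z}) (u := fun n _ => u n) hT (Set.singleton_subset_iff.2 hzW)
    (fun n x _ => sol_continuousOn n) (fun n x hx => by rw [Set.mem_singleton_iff.1 hx]; exact sol_init n)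
    (fun n x _ t ht => (sol_hasDerivWithinAt n t (Ioo_subset_Icc_self ht)).hasDerivAt
      (Icc_mem_nhds ht.1 ht.2))
    (fun n x _ t ht => hmem n t ht) (fun n x _ => sol_proj n)⟩

omit [DecidableEq d] [InnerProductSpace ℂ V] [CompleteSpace V] [ProperSpace V] in
/-- A rapidly decreasing element sits under a polynomial floor of scaled order `d + 3`:
`‖z k‖ ≤ C_z ⟨k⟩^{−(d+3)}` with `C_z = ‖z‖_{d+3}` (`norm_apply_le_of_eNormSq_le`). -/
theorem exists_floor_of_rapidDecay {z : lp (fun _ : (d → ℤ) => V) 2} (hzr : RapidDecay (⇑z)) :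
    ∃ Cz : ℝ, 0 ≤ Cz ∧ ∀ k, ‖(z : (d → ℤ) → V) k‖ ≤ Cz * sobolevWeight (-((Fintype.card d : ℝ) + 3)) k := by
  have hzfin : eNormSq ((Fintype.card d : ℝ) + 3) (⇑z) < ∞ := eNormSq_lt_top_of_rapidDecay hzr _
  exact ⟨Real.sqrt (eNormSq ((Fintype.card d : ℝ) + 3) (⇑z)).toReal, Real.sqrt_nonneg _, fun k =>
    norm_apply_le_of_eNormSq_le hzfin le_rfl k⟩

end Setting

/-! ## §3 Existence: the uniform limit of the levels is a classical solution in the class -/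

section Existence

/-- **NON-VACUITY of the R-β words: the true solution EXISTS on the window**
(`exists_solution_of_levelBound`). Hypotheses: host data (`ν > 0`; `Uv` rapidly decreasing, real and
divergence-free through `π`; `‖π_j‖ ≤ 1`; `P` modewise self-adjoint contractions;
`σ₂² = ∑⟨l⟩⁻⁴ < ∞`), `T ≥ 0`, a rapidly decreasing constrained seed `z`, and its Galerkin levels
`u n` at `cubeProj (n + K)` on `[0, T]` as `C¹` solutions of the finite-dimensional ODE keeping the
three clauses with ONE `E`-bound `‖u n t‖ ≤ r`. Conclusion: there is `w : ℝ → E` which is the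
uniform limit of the levels on `[0, T]`, continuous on `[0, T]`, `w 0 = z`, solving `w' = F(w)` on
`(0, T)`, with a uniform polynomial tail of scaled order `d + 3` and the three clauses on `[0, T]`. -/
theorem exists_solution_of_levelBound (K : ℕ) (hν : 0 < ν) (hUv : RapidDecay Uv)
    (hUreal : ∀ j p, π j (Uv (-p)) = conj (π j (Uv p)))
    (hUdiv : ∑ j, freqDeriv j (fun p => π j (Uv p)) = 0) (hπ : ∀ j, ‖π j‖ ≤ 1)
    (hPsa : ∀ k, IsSelfAdjoint (P k)) (hPn : ∀ k, ‖P k‖ ≤ 1)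
    (hσ : ∑' l : d → ℤ, ENNReal.ofReal (sobolevWeight (-2) l ^ 2) < ∞)
    {T : ℝ} (hT : 0 ≤ T)
    {z : lp (fun _ : (d → ℤ) => V) 2} (hzr : RapidDecay (⇑z))
    (hzfix : ∀ k, P k (z k) = z k) (hzreal : ∀ j k, π j (z (-k)) = conj (π j (z k)))
    (hzdiv : ∀ k, ∑ j, ((k j : ℤ) : ℂ) * π j (z k) = 0)
    {u : ℕ → ℝ → lp (fun _ : (d → ℤ) => V) 2} {r : ℝ} (hr : 0 < r)
    (sol_continuousOn : ∀ n, ContinuousOn (u n) (Icc 0 T))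
    (sol_init : ∀ n, u n 0 = cubeProj (n + K) z)
    (sol_hasDerivWithinAt : ∀ n, ∀ t ∈ Icc 0 T,
      HasDerivWithinAt (u n) (cubeProj (n + K) (nsField ν Uv π P (u n t))) (Icc 0 T) t)
    (sol_proj : ∀ n, ∀ t ∈ Icc 0 T, cubeProj (n + K) (u n t) = u n t)
    (sol_fix : ∀ n, ∀ t ∈ Icc 0 T, ∀ k, P k ((u n t : (d → ℤ) → V) k) = (u n t : (d → ℤ) → V) k)
    (sol_real : ∀ n, ∀ t ∈ Icc 0 T, ∀ j k,
      π j ((u n t : (d → ℤ) → V) (-k)) = conj (π j ((u n t : (d → ℤ) → V) k)))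
    (sol_div : ∀ n, ∀ t ∈ Icc 0 T, ∀ k, ∑ j, ((k j : ℤ) : ℂ) * π j ((u n t : (d → ℤ) → V) k) = 0)
    (sol_bound : ∀ n, ∀ t ∈ Icc 0 T, ‖u n t‖ ≤ r) :
    ∃ w : ℝ → lp (fun _ : (d → ℤ) => V) 2,
      TendstoUniformlyOn (fun n t => u n t) w atTop (Icc 0 T) ∧
      ContinuousOn w (Icc 0 T) ∧ w 0 = z ∧
      (∀ t ∈ Ioo 0 T, HasDerivAt w (nsField ν Uv π P (w t)) t) ∧
      (∃ Cw : ℝ, 0 ≤ Cw ∧ ∀ t ∈ Icc 0 T, ∀ k,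
        ‖(w t : (d → ℤ) → V) k‖ ≤ Cw * sobolevWeight (-((Fintype.card d : ℝ) + 3)) k) ∧
      (∀ t ∈ Icc 0 T, ∀ k, P k ((w t : (d → ℤ) → V) k) = (w t : (d → ℤ) → V) k) ∧
      (∀ t ∈ Icc 0 T, ∀ j k, π j ((w t : (d → ℤ) → V) (-k)) = conj (π j ((w t : (d → ℤ) → V) k))) ∧
      (∀ t ∈ Icc 0 T, ∀ k, ∑ j, ((k j : ℤ) : ℂ) * π j ((w t : (d → ℤ) → V) k) = 0) := by
  obtain ⟨Cz, hCz0, hzdec⟩ := exists_floor_of_rapidDecay hzr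
  obtain ⟨Cρ, l, hCρ, hset⟩ := exists_setting_of_levelBound K hν hUv hUreal hUdiv hπ hPsa hPn hσ hT hzr
    hCz0 hzdec hzfix hzreal hzdiv hr sol_continuousOn sol_init sol_hasDerivWithinAt sol_proj sol_fix
    sol_real sol_div sol_bound
  obtain ⟨φ, hconv, hsol, -, -⟩ := hset.exists_limit
  obtain ⟨h0, hcont, hW, hder⟩ := hsol z (Set.mem_singleton z)
  refine ⟨φ z, (hconv.comp fun t : ℝ => (z, t)).mono fun t ht =>
      (⟨Set.mem_singleton z, ht⟩ : (z, t) ∈ ({z} : Set _) ×ˢ Icc 0 T),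
    hcont, h0, hder, ⟨Cρ, hCz0.trans hCρ, fun t ht k => (mem_box.1 (hW t ht)).1 k⟩,
    fun t ht => (mem_box.1 (hW t ht)).2.1, fun t ht => (mem_box.1 (hW t ht)).2.2.1,
    fun t ht => (mem_box.1 (hW t ht)).2.2.2⟩

end Existence

/-! ## §4 Uniqueness in the class: every class solution is the limit of the levels -/

section Uniqueness

/-- **Every classical solution in the class is the uniform limit of the Galerkin levels**
(`tendstoUniformlyOn_of_solution`): under the hypotheses of `exists_solution_of_levelBound`, a
solution `w` on `[0, T]` from `z` (continuous on `[0, T]`, `w' = F(w)` on `(0, T)`) with a uniform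
polynomial tail of scaled order `d + 3` (ANY constant `C_w`) and the three clauses is the uniform limit
of `u n` on `[0, T]` (Wilczak–Zgliczyński `limit_unique` in the box whose floor covers `z` and `w`). -/
theorem tendstoUniformlyOn_of_solution (K : ℕ) (hν : 0 < ν) (hUv : RapidDecay Uv)
    (hUreal : ∀ j p, π j (Uv (-p)) = conj (π j (Uv p)))
    (hUdiv : ∑ j, freqDeriv j (fun p => π j (Uv p)) = 0) (hπ : ∀ j, ‖π j‖ ≤ 1)
    (hPsa : ∀ k, IsSelfAdjoint (P k)) (hPn : ∀ k, ‖P k‖ ≤ 1)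
    (hσ : ∑' l : d → ℤ, ENNReal.ofReal (sobolevWeight (-2) l ^ 2) < ∞)
    {T : ℝ} (hT : 0 ≤ T)
    {z : lp (fun _ : (d → ℤ) => V) 2} (hzr : RapidDecay (⇑z))
    (hzfix : ∀ k, P k (z k) = z k) (hzreal : ∀ j k, π j (z (-k)) = conj (π j (z k)))
    (hzdiv : ∀ k, ∑ j, ((k j : ℤ) : ℂ) * π j (z k) = 0)
    {u : ℕ → ℝ → lp (fun _ : (d → ℤ) => V) 2} {r : ℝ} (hr : 0 < r)
    (sol_continuousOn : ∀ n, ContinuousOn (u n) (Icc 0 T))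
    (sol_init : ∀ n, u n 0 = cubeProj (n + K) z)
    (sol_hasDerivWithinAt : ∀ n, ∀ t ∈ Icc 0 T,
      HasDerivWithinAt (u n) (cubeProj (n + K) (nsField ν Uv π P (u n t))) (Icc 0 T) t)
    (sol_proj : ∀ n, ∀ t ∈ Icc 0 T, cubeProj (n + K) (u n t) = u n t)
    (sol_fix : ∀ n, ∀ t ∈ Icc 0 T, ∀ k, P k ((u n t : (d → ℤ) → V) k) = (u n t : (d → ℤ) → V) k)
    (sol_real : ∀ n, ∀ t ∈ Icc 0 T, ∀ j k,
      π j ((u n t : (d → ℤ) → V) (-k)) = conj (π j ((u n t : (d → ℤ) → V) k)))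
    (sol_div : ∀ n, ∀ t ∈ Icc 0 T, ∀ k, ∑ j, ((k j : ℤ) : ℂ) * π j ((u n t : (d → ℤ) → V) k) = 0)
    (sol_bound : ∀ n, ∀ t ∈ Icc 0 T, ‖u n t‖ ≤ r)
    {w : ℝ → lp (fun _ : (d → ℤ) => V) 2} (hw : ContinuousOn w (Icc 0 T)) (hw0 : w 0 = z)
    (hw' : ∀ t ∈ Ioo 0 T, HasDerivAt w (nsField ν Uv π P (w t)) t)
    {Cw : ℝ} (hCw : 0 ≤ Cw)
    (hwdec : ∀ t ∈ Icc 0 T, ∀ k, ‖(w t : (d → ℤ) → V) k‖ ≤ Cw * sobolevWeight (-((Fintype.card d : ℝ) + 3)) k)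
    (hwfix : ∀ t ∈ Icc 0 T, ∀ k, P k ((w t : (d → ℤ) → V) k) = (w t : (d → ℤ) → V) k)
    (hwreal : ∀ t ∈ Icc 0 T, ∀ j k, π j ((w t : (d → ℤ) → V) (-k)) = conj (π j ((w t : (d → ℤ) → V) k)))
    (hwdiv : ∀ t ∈ Icc 0 T, ∀ k, ∑ j, ((k j : ℤ) : ℂ) * π j ((w t : (d → ℤ) → V) k) = 0) :
    TendstoUniformlyOn (fun n t => u n t) w atTop (Icc 0 T) := by
  obtain ⟨Cz, hCz0, hzdec⟩ := exists_floor_of_rapidDecay hzr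
  -- a floor covering both the seed and `w`
  have hzdec' : ∀ k, ‖(z : (d → ℤ) → V) k‖ ≤ (Cz + Cw) * sobolevWeight (-((Fintype.card d : ℝ) + 3)) k :=
    fun k => (hzdec k).trans (mul_le_mul_of_nonneg_right (le_add_of_nonneg_right hCw)
      (sobolevWeight_pos _ _).le)
  obtain ⟨Cρ, l, hCρ, hset⟩ := exists_setting_of_levelBound K hν hUv hUreal hUdiv hπ hPsa hPn hσ hT hzr
    (add_nonneg hCz0 hCw) hzdec' hzfix hzreal hzdiv hr sol_continuousOn sol_init sol_hasDerivWithinAt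
    sol_proj sol_fix sol_real sol_div sol_bound
  obtain ⟨φ, hφ⟩ := hset.exists_tendstoUniformlyOn
  have hwW : ∀ t ∈ Icc 0 T, w t ∈ box (fun k => Cρ * sobolevWeight (-((Fintype.card d : ℝ) + 3)) k) π P :=
    fun t ht => mem_box.2 ⟨fun k => (hwdec t ht k).trans (mul_le_mul_of_nonneg_right
      ((le_add_of_nonneg_left hCz0).trans hCρ) (sobolevWeight_pos _ _).le),
      hwfix t ht, hwreal t ht, hwdiv t ht⟩
  have heq : ∀ t ∈ Icc 0 T, w t = φ z t := fun t ht =>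
    hset.limit_unique hφ (Set.mem_singleton z) hw hw0 hw' hwW ht
  exact ((hφ.comp fun t : ℝ => (z, t)).mono fun t ht =>
      (⟨Set.mem_singleton z, ht⟩ : (z, t) ∈ ({z} : Set _) ×ˢ Icc 0 T)).congr_right
    fun t ht => (heq t ht).symm

/-- **UNIQUENESS IN THE CLASS** (`eqOn_of_solutions`): under the hypotheses of
`exists_solution_of_levelBound`, two classical solutions on `[0, T]` from the same seed `z`, each
with a uniform polynomial tail of scaled order `d + 3` and the three clauses, coincide on `[0, T]`
(both are the uniform limit of the same levels): the solution of `exists_solution_of_levelBound` is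
THE solution in the class, and the KEEP/KILL sentences of record are statements about it. -/
theorem eqOn_of_solutions (K : ℕ) (hν : 0 < ν) (hUv : RapidDecay Uv)
    (hUreal : ∀ j p, π j (Uv (-p)) = conj (π j (Uv p)))
    (hUdiv : ∑ j, freqDeriv j (fun p => π j (Uv p)) = 0) (hπ : ∀ j, ‖π j‖ ≤ 1)
    (hPsa : ∀ k, IsSelfAdjoint (P k)) (hPn : ∀ k, ‖P k‖ ≤ 1)
    (hσ : ∑' l : d → ℤ, ENNReal.ofReal (sobolevWeight (-2) l ^ 2) < ∞)
    {T : ℝ} (hT : 0 ≤ T)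
    {z : lp (fun _ : (d → ℤ) => V) 2} (hzr : RapidDecay (⇑z))
    (hzfix : ∀ k, P k (z k) = z k) (hzreal : ∀ j k, π j (z (-k)) = conj (π j (z k)))
    (hzdiv : ∀ k, ∑ j, ((k j : ℤ) : ℂ) * π j (z k) = 0)
    {u : ℕ → ℝ → lp (fun _ : (d → ℤ) => V) 2} {r : ℝ} (hr : 0 < r)
    (sol_continuousOn : ∀ n, ContinuousOn (u n) (Icc 0 T))
    (sol_init : ∀ n, u n 0 = cubeProj (n + K) z)
    (sol_hasDerivWithinAt : ∀ n, ∀ t ∈ Icc 0 T,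
      HasDerivWithinAt (u n) (cubeProj (n + K) (nsField ν Uv π P (u n t))) (Icc 0 T) t)
    (sol_proj : ∀ n, ∀ t ∈ Icc 0 T, cubeProj (n + K) (u n t) = u n t)
    (sol_fix : ∀ n, ∀ t ∈ Icc 0 T, ∀ k, P k ((u n t : (d → ℤ) → V) k) = (u n t : (d → ℤ) → V) k)
    (sol_real : ∀ n, ∀ t ∈ Icc 0 T, ∀ j k,
      π j ((u n t : (d → ℤ) → V) (-k)) = conj (π j ((u n t : (d → ℤ) → V) k)))
    (sol_div : ∀ n, ∀ t ∈ Icc 0 T, ∀ k, ∑ j, ((k j : ℤ) : ℂ) * π j ((u n t : (d → ℤ) → V) k) = 0)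
    (sol_bound : ∀ n, ∀ t ∈ Icc 0 T, ‖u n t‖ ≤ r)
    {w₁ : ℝ → lp (fun _ : (d → ℤ) => V) 2} (hw₁ : ContinuousOn w₁ (Icc 0 T)) (hw₁0 : w₁ 0 = z)
    (hw₁' : ∀ t ∈ Ioo 0 T, HasDerivAt w₁ (nsField ν Uv π P (w₁ t)) t)
    {C₁ : ℝ} (hC₁ : 0 ≤ C₁)
    (hw₁dec : ∀ t ∈ Icc 0 T, ∀ k, ‖(w₁ t : (d → ℤ) → V) k‖ ≤ C₁ * sobolevWeight (-((Fintype.card d : ℝ) + 3)) k)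
    (hw₁fix : ∀ t ∈ Icc 0 T, ∀ k, P k ((w₁ t : (d → ℤ) → V) k) = (w₁ t : (d → ℤ) → V) k)
    (hw₁real : ∀ t ∈ Icc 0 T, ∀ j k, π j ((w₁ t : (d → ℤ) → V) (-k)) = conj (π j ((w₁ t : (d → ℤ) → V) k)))
    (hw₁div : ∀ t ∈ Icc 0 T, ∀ k, ∑ j, ((k j : ℤ) : ℂ) * π j ((w₁ t : (d → ℤ) → V) k) = 0)
    {w₂ : ℝ → lp (fun _ : (d → ℤ) => V) 2} (hw₂ : ContinuousOn w₂ (Icc 0 T)) (hw₂0 : w₂ 0 = z)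
    (hw₂' : ∀ t ∈ Ioo 0 T, HasDerivAt w₂ (nsField ν Uv π P (w₂ t)) t)
    {C₂ : ℝ} (hC₂ : 0 ≤ C₂)
    (hw₂dec : ∀ t ∈ Icc 0 T, ∀ k, ‖(w₂ t : (d → ℤ) → V) k‖ ≤ C₂ * sobolevWeight (-((Fintype.card d : ℝ) + 3)) k)
    (hw₂fix : ∀ t ∈ Icc 0 T, ∀ k, P k ((w₂ t : (d → ℤ) → V) k) = (w₂ t : (d → ℤ) → V) k)
    (hw₂real : ∀ t ∈ Icc 0 T, ∀ j k, π j ((w₂ t : (d → ℤ) → V) (-k)) = conj (π j ((w₂ t : (d → ℤ) → V) k)))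
    (hw₂div : ∀ t ∈ Icc 0 T, ∀ k, ∑ j, ((k j : ℤ) : ℂ) * π j ((w₂ t : (d → ℤ) → V) k) = 0) :
    EqOn w₁ w₂ (Icc 0 T) := by
  have h₁ := tendstoUniformlyOn_of_solution K hν hUv hUreal hUdiv hπ hPsa hPn hσ hT hzr hzfix hzreal hzdiv hr
    sol_continuousOn sol_init sol_hasDerivWithinAt sol_proj sol_fix sol_real sol_div sol_bound hw₁ hw₁0 hw₁'
    hC₁ hw₁dec hw₁fix hw₁real hw₁div
  have h₂ := tendstoUniformlyOn_of_solution K hν hUv hUreal hUdiv hπ hPsa hPn hσ hT hzr hzfix hzreal hzdiv hr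
    sol_continuousOn sol_init sol_hasDerivWithinAt sol_proj sol_fix sol_real sol_div sol_bound hw₂ hw₂0 hw₂'
    hC₂ hw₂dec hw₂fix hw₂real hw₂div
  exact fun t ht => tendsto_nhds_unique (h₁.tendsto_at ht) (h₂.tendsto_at ht)

end Uniqueness

end Summit.NavierStokesRegularity.FluidComputer.TransportGalerkinExistence

end
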